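import Summits.BirchSwinnertonDyer.Rank1Residual.X11b.Three.LambdaSupplyTwistFamily
import Literature.NumberTheory.EllipticCurves.ZpExtensionUnramifiedProofs
import HarnessLib

/-!
# X11b @ `p = 3`, S28-c (K2) 'TWIST-SUPPLY', part 2: the admissible pairs `(λ, r_λ)` of the
# λ-supply form ONE orbit under the finite `p`-power-order characters through `Γ⁻`

HONEST FRAMING (cell `b2b-bsdres`, run/shared/lean/b2b/bsd-rank1-residual/, verbatim in every
file): the goal of the cell is to DELETE the COMBINATION-SHAPED residual classes of the
Birch–Swinnerton-Dyer formula for ALL analytic-rank `≤ 1` elliptic curves over `ℚ` — assembled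
STRICTLY from published theorems — so that the rank-`≤ 1` remainder becomes exactly the
CONSTRUCTION-SHAPED classes, which are TYPED, NOT attempted. This is not "finishing BSD". Team N8/O2
(X11b at `3`: `3 ‖ N`, `r_an = 1`, `E[3]` irreducible): research route; nothing booked; NO label
changes; O2 stays OPEN; S28 RE-EXPRESSES the descent node `Three.HsiehDescentAt₃` (a READING — H45:
nothing 'shrinks'). THEOREMS ONLY (Galois/Hecke bookkeeping over PROVED tree infrastructure); no
definition, no fact, no `sorry`. 'Admissible' is SPELLED OUT each time as the six clauses
[08]–[13] of `hsieh2014_exists_anticyclotomicPAdicLFunction`; the twist 'ε' is a PAIR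
`(μ, r_μ)` (Hecke character, rank-one framed `p`-adic representation).

PROVENANCE: sub-target S28 'COMMON-FRAME RE-EXPRESSION OF THE DESCENT NODE', piece **S28-c =
(K2) 'twist-supply'** (lead GEN 7 R8-18 / R8-22 (d) / INBOX 2026-08-21 12:48Z nominal), seat
`b2b-bsdres-x11b3-p2` (gen. 4); intended signatures posted before proving (HOME/INBOX.md, same
seat). Inputs: this seat's S24-a (C) files `LambdaSupplyTransport` / `LambdaSupplyQuotient`,
p7's (B) `LambdaSupplyAvatar` (`hasInfinityType_zero_of_isFiniteOrder`), the Langlands-side tree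
theorem `stub_isFiniteOrder_of_hasInfinityType_zero` (Neukirch VII (6.9)/(6.14): type `(0,0)` ⇒
finite order) and Hecke rigidity `HeckeCharacter.eq_of_hasFrobCharpolyAt_eventually`
(`WeakAbelianDirectSummandProofs`).

## What this file proves (`K` a number field, `[K:ℚ] = 2` Galois where stated; `p` prime, odd where
## stated; `ι : ℚ̄_p ≃ ℂ`; `κ : Γ_K ↠ ℤ_p`; `e = FramedRep.unitsContinuousMulEquivOfUnique (Fin 1) ℚ̄_p`)

* §1–§5 (anti-invariance (K2-d), rigidity, (K2-c) `apply_ideleBaseChange_eq_one_of_pow_eq_one`,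
  powers, `p`-power order `exists_pow_prime_pow_eq_one`) are the first file
  `X11b/Three/LambdaSupplyTwistFamily.lean`; this sequel proves:
* §6 **`twist_admissible` (K2-a)**: (λ, r_λ) admissible of type `(1,−1)` and ε = (μ, r_μ) with
  `μ^{p^k} = 1`, μ unramified outside `p`, `IsPAdicAvatarOf ι μ r_μ`, `FactorsThroughZp κ r_μ` ⇒
  (λ·μ, e∘(e⁻¹∘r_λ · e⁻¹∘r_μ)) admissible of type `(1,−1)` (the `𝕀_ℚ`-clause of μ is DERIVED by (K2-c)).
* §7 **`quotient_admissible` (K2-b)**: two admissible pairs ⇒ their quotient (λ′λ⁻¹, r_λ′ r_λ⁻¹) is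
  unitary of type `(0,0)`, trivial on `𝕀_ℚ`, unramified outside `p`, with avatar through `κ`, of
  FINITE order and of `p`-POWER order. Reading (R8-18): the admissible set is exactly
  `λ₀ · {ε : ε̂ ∈ Hom_cont(Γ⁻, μ_{p^∞})}`.

## References

* R. Greenberg, *Non-vanishing of certain values of `L`-functions*, Progr. Math. 70 (1987), §2
  (anticyclotomic characters: `χ ∘ c = χ⁻¹`). [Greenberg1987]
* J. Neukirch, *Algebraic Number Theory* (1999), Ch. VII §6, Prop. (6.9), Cor. (6.14) (type `(0,0)`
  characters have finite order). [NeukirchANT1999]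
* J. W. S. Cassels, A. Fröhlich (eds.), *Algebraic Number Theory* (1967), Ch. VII §4, Prop. 4.1
  (a Hecke character is determined by almost all Frobenius values). [CasselsFrohlichANT1967]
* M.-L. Hsieh, *Special values of anticyclotomic Rankin–Selberg L-functions*, Doc. Math. 19
  (2014), Thm. 1 (the admissible `λ`). [Hsieh2014]
-/
noncomputable section

open scoped NumberField Polynomial
open NumberField IsDedekindDomain Field Polynomial Filter
  Literature.NumberTheory.GaloisRepresentations Literature.NumberTheory.EllipticCurves
  Literature.NumberTheory.Automorphic

namespace Summit.BirchSwinnertonDyer.Rank1Residual.X11b.Three.LambdaSupply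

variable {K : Type} [Field K] [NumberField K] {p : ℕ} [Fact p.Prime]

/-! ### §6. (K2-a): twisting an admissible pair by `ε = (μ, r_μ)` -/

/-- **(K2-a) TWIST-SUPPLY, action.** Let `(λ, r_λ)` satisfy the six admissibility clauses
[08]–[13] of `hsieh2014_exists_anticyclotomicPAdicLFunction` (unitary; infinity type `(1, −1)`;
trivial on `𝕀_ℚ`; unramified outside `p`; `r_λ` its avatar; `r_λ` factors through `κ`), and let
`ε = (μ, r_μ)` be a Hecke character of finite `p`-power order (`μ^{p^k} = 1`), unramified outside
`p`, with avatar `r_μ` factoring through the anticyclotomic `κ`. Then `(λ·μ, r_λ·r_μ)` satisfies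
the six clauses again (the product of rank-one avatars taken in the tree's `e ∘ ψ` currency). The
`𝕀_ℚ`-triviality of `μ` is NOT assumed: it is (K2-c). [folklore] -/
theorem twist_admissible [IsGalois ℚ K] (hK : Module.finrank ℚ K = 2) (hp : p ≠ 2)
    (ι : PadicAlgCl p ≃+* ℂ) {κ : ZpExtension K p} (hκ : κ.IsAnticyclotomic)
    {lam μ : HeckeCharacter K} {rlam rμ : FramedGaloisRep K (PadicAlgCl p) 1}
    (h8 : lam.IsUnitary) (h9 : lam.HasInfinityType (fun _ ↦ (1 : ℤ)) (fun _ ↦ (-1 : ℤ)))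
    (h10 : ∀ x : ideleGroup ℚ, lam (AdeleRing.ideleBaseChange ℚ K x) = 1)
    (h11 : ∀ v : HeightOneSpectrum (𝓞 K), ((p : ℕ) : 𝓞 K) ∉ v.asIdeal → lam.IsUnramifiedAt v)
    (h12 : IsPAdicAvatarOf ι lam rlam) (h13 : FactorsThroughZp κ rlam)
    {k : ℕ} (hμk : μ ^ (p ^ k) = 1)
    (hμ11 : ∀ v : HeightOneSpectrum (𝓞 K), ((p : ℕ) : 𝓞 K) ∉ v.asIdeal → μ.IsUnramifiedAt v)
    (hμ12 : IsPAdicAvatarOf ι μ rμ) (hμ13 : FactorsThroughZp κ rμ) :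
    (lam * μ).IsUnitary ∧
    (lam * μ).HasInfinityType (fun _ ↦ (1 : ℤ)) (fun _ ↦ (-1 : ℤ)) ∧
    (∀ x : ideleGroup ℚ, (lam * μ) (AdeleRing.ideleBaseChange ℚ K x) = 1) ∧
    (∀ v : HeightOneSpectrum (𝓞 K), ((p : ℕ) : 𝓞 K) ∉ v.asIdeal → (lam * μ).IsUnramifiedAt v) ∧
    IsPAdicAvatarOf ι (lam * μ) ((FramedRep.unitsContinuousMulEquivOfUnique (Fin 1) (PadicAlgCl p) :
      (PadicAlgCl p)ˣ →ₜ* GL (Fin 1) (PadicAlgCl p)).comp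
      (((FramedRep.unitsContinuousMulEquivOfUnique (Fin 1) (PadicAlgCl p)).symm :
      GL (Fin 1) (PadicAlgCl p) →ₜ* (PadicAlgCl p)ˣ).comp rlam * ((FramedRep.unitsContinuousMulEquivOfUnique (Fin 1) (PadicAlgCl p)).symm :
      GL (Fin 1) (PadicAlgCl p) →ₜ* (PadicAlgCl p)ˣ).comp rμ)) ∧
    FactorsThroughZp κ ((FramedRep.unitsContinuousMulEquivOfUnique (Fin 1) (PadicAlgCl p) :
      (PadicAlgCl p)ˣ →ₜ* GL (Fin 1) (PadicAlgCl p)).comp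
      (((FramedRep.unitsContinuousMulEquivOfUnique (Fin 1) (PadicAlgCl p)).symm :
      GL (Fin 1) (PadicAlgCl p) →ₜ* (PadicAlgCl p)ˣ).comp rlam * ((FramedRep.unitsContinuousMulEquivOfUnique (Fin 1) (PadicAlgCl p)).symm :
      GL (Fin 1) (PadicAlgCl p) →ₜ* (PadicAlgCl p)ˣ).comp rμ)) := by
  have hpp : p.Prime := Fact.out
  have hfin : μ.IsFiniteOrder := isOfFinOrder_iff_pow_eq_one.mpr ⟨p ^ k, pow_pos hpp.pos k, hμk⟩
  -- avatars in `e ∘ ψ` currency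
  have h12' : IsPAdicAvatarOf ι lam ((FramedRep.unitsContinuousMulEquivOfUnique (Fin 1) (PadicAlgCl p) :
      (PadicAlgCl p)ˣ →ₜ* GL (Fin 1) (PadicAlgCl p)).comp (((FramedRep.unitsContinuousMulEquivOfUnique (Fin 1) (PadicAlgCl p)).symm :
      GL (Fin 1) (PadicAlgCl p) →ₜ* (PadicAlgCl p)ˣ).comp rlam)) := by
    rwa [comp_symm_comp_eq]
  have hμ12' : IsPAdicAvatarOf ι μ ((FramedRep.unitsContinuousMulEquivOfUnique (Fin 1) (PadicAlgCl p) :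
      (PadicAlgCl p)ˣ →ₜ* GL (Fin 1) (PadicAlgCl p)).comp (((FramedRep.unitsContinuousMulEquivOfUnique (Fin 1) (PadicAlgCl p)).symm :
      GL (Fin 1) (PadicAlgCl p) →ₜ* (PadicAlgCl p)ˣ).comp rμ)) := by
    rwa [comp_symm_comp_eq]
  refine ⟨h8.mul hfin.isUnitary, ?_, fun x => ?_, fun v hv => (h11 v hv).mul' (hμ11 v hv), ?_, ?_⟩
  · have := h9.mul' (hasInfinityType_zero_of_isFiniteOrder hfin)
    rwa [add_zero, add_zero] at this
  · rw [HeckeCharacter.mul_apply, h10 x,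
      apply_ideleBaseChange_eq_one_of_pow_eq_one hK hp ι hκ hμ12 hμ13 hμ11 hμk x, mul_one]
  · exact isPAdicAvatarOf_mul ι h12' hμ12' (hram_of_forall h11 hμ11)
  · refine (factorsThroughZp_unitsChar_iff κ _).2 fun σ hσ => ?_
    rw [ContinuousMonoidHom.mul_apply, ContinuousMonoidHom.coe_comp, ContinuousMonoidHom.coe_comp,
      Function.comp_apply, Function.comp_apply, h13 σ hσ, hμ13 σ hσ, map_one, mul_one]

/-! ### §7. (K2-b): two admissible pairs differ by such an `ε` -/

/-- **(K2-b) TWIST-SUPPLY, difference.** If `(λ, r_λ)` and `(λ′, r_λ′)` both satisfy the six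
admissibility clauses (type `(1, −1)`), then `ε = (μ, r_μ) := (λ′·λ⁻¹, r_λ′·r_λ⁻¹)` is a Hecke
character which is unitary of infinity type `(0, 0)`, trivial on `𝕀_ℚ`, unramified outside `p`,
with avatar `r_μ` factoring through `κ`; it has FINITE order
(`stub_isFiniteOrder_of_hasInfinityType_zero`, the tree's Neukirch VII (6.9)/(6.14) theorem) and
indeed finite `p`-POWER order (`exists_pow_prime_pow_eq_one`). So the admissible pairs form ONE orbit
under the `ε` of (K2-a). [folklore] -/
theorem quotient_admissible (ι : PadicAlgCl p ≃+* ℂ) {κ : ZpExtension K p}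
    {lam lam' : HeckeCharacter K} {rlam rlam' : FramedGaloisRep K (PadicAlgCl p) 1}
    (h8 : lam.IsUnitary) (h9 : lam.HasInfinityType (fun _ ↦ (1 : ℤ)) (fun _ ↦ (-1 : ℤ)))
    (h10 : ∀ x : ideleGroup ℚ, lam (AdeleRing.ideleBaseChange ℚ K x) = 1)
    (h11 : ∀ v : HeightOneSpectrum (𝓞 K), ((p : ℕ) : 𝓞 K) ∉ v.asIdeal → lam.IsUnramifiedAt v)
    (h12 : IsPAdicAvatarOf ι lam rlam) (h13 : FactorsThroughZp κ rlam)
    (h8' : lam'.IsUnitary) (h9' : lam'.HasInfinityType (fun _ ↦ (1 : ℤ)) (fun _ ↦ (-1 : ℤ)))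
    (h10' : ∀ x : ideleGroup ℚ, lam' (AdeleRing.ideleBaseChange ℚ K x) = 1)
    (h11' : ∀ v : HeightOneSpectrum (𝓞 K), ((p : ℕ) : 𝓞 K) ∉ v.asIdeal → lam'.IsUnramifiedAt v)
    (h12' : IsPAdicAvatarOf ι lam' rlam') (h13' : FactorsThroughZp κ rlam') :
    (lam' * lam⁻¹).IsUnitary ∧
    (lam' * lam⁻¹).HasInfinityType 0 0 ∧
    (∀ x : ideleGroup ℚ, (lam' * lam⁻¹) (AdeleRing.ideleBaseChange ℚ K x) = 1) ∧
    (∀ v : HeightOneSpectrum (𝓞 K), ((p : ℕ) : 𝓞 K) ∉ v.asIdeal → (lam' * lam⁻¹).IsUnramifiedAt v) ∧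
    IsPAdicAvatarOf ι (lam' * lam⁻¹) ((FramedRep.unitsContinuousMulEquivOfUnique (Fin 1) (PadicAlgCl p) :
      (PadicAlgCl p)ˣ →ₜ* GL (Fin 1) (PadicAlgCl p)).comp
      (((FramedRep.unitsContinuousMulEquivOfUnique (Fin 1) (PadicAlgCl p)).symm :
      GL (Fin 1) (PadicAlgCl p) →ₜ* (PadicAlgCl p)ˣ).comp rlam' * (((FramedRep.unitsContinuousMulEquivOfUnique (Fin 1) (PadicAlgCl p)).symm :
      GL (Fin 1) (PadicAlgCl p) →ₜ* (PadicAlgCl p)ˣ).comp rlam)⁻¹)) ∧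
    FactorsThroughZp κ ((FramedRep.unitsContinuousMulEquivOfUnique (Fin 1) (PadicAlgCl p) :
      (PadicAlgCl p)ˣ →ₜ* GL (Fin 1) (PadicAlgCl p)).comp
      (((FramedRep.unitsContinuousMulEquivOfUnique (Fin 1) (PadicAlgCl p)).symm :
      GL (Fin 1) (PadicAlgCl p) →ₜ* (PadicAlgCl p)ˣ).comp rlam' * (((FramedRep.unitsContinuousMulEquivOfUnique (Fin 1) (PadicAlgCl p)).symm :
      GL (Fin 1) (PadicAlgCl p) →ₜ* (PadicAlgCl p)ˣ).comp rlam)⁻¹)) ∧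
    (lam' * lam⁻¹).IsFiniteOrder ∧ ∃ k : ℕ, (lam' * lam⁻¹) ^ (p ^ k) = 1 := by
  have h12e : IsPAdicAvatarOf ι lam ((FramedRep.unitsContinuousMulEquivOfUnique (Fin 1) (PadicAlgCl p) :
      (PadicAlgCl p)ˣ →ₜ* GL (Fin 1) (PadicAlgCl p)).comp (((FramedRep.unitsContinuousMulEquivOfUnique (Fin 1) (PadicAlgCl p)).symm :
      GL (Fin 1) (PadicAlgCl p) →ₜ* (PadicAlgCl p)ˣ).comp rlam)) := by
    rwa [comp_symm_comp_eq]
  have h12e' : IsPAdicAvatarOf ι lam' ((FramedRep.unitsContinuousMulEquivOfUnique (Fin 1) (PadicAlgCl p) :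
      (PadicAlgCl p)ˣ →ₜ* GL (Fin 1) (PadicAlgCl p)).comp (((FramedRep.unitsContinuousMulEquivOfUnique (Fin 1) (PadicAlgCl p)).symm :
      GL (Fin 1) (PadicAlgCl p) →ₜ* (PadicAlgCl p)ˣ).comp rlam')) := by
    rwa [comp_symm_comp_eq]
  have htype : (lam' * lam⁻¹).HasInfinityType 0 0 := by
    have := h9'.mul' h9.inv
    have e1 : ((fun _ : InfinitePlace K ↦ (1 : ℤ)) + -fun _ : InfinitePlace K ↦ (1 : ℤ)) = 0 := by
      funext w; simp
    have e2 : ((fun _ : InfinitePlace K ↦ (-1 : ℤ)) + -fun _ : InfinitePlace K ↦ (-1 : ℤ)) = 0 := by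
      funext w; simp
    rwa [e1, e2] at this
  have hunr : ∀ v : HeightOneSpectrum (𝓞 K), ((p : ℕ) : 𝓞 K) ∉ v.asIdeal →
      (lam' * lam⁻¹).IsUnramifiedAt v := fun v hv => (h11' v hv).mul' (h11 v hv).inv'
  have havatar : IsPAdicAvatarOf ι (lam' * lam⁻¹) ((FramedRep.unitsContinuousMulEquivOfUnique (Fin 1) (PadicAlgCl p) :
      (PadicAlgCl p)ˣ →ₜ* GL (Fin 1) (PadicAlgCl p)).comp
      (((FramedRep.unitsContinuousMulEquivOfUnique (Fin 1) (PadicAlgCl p)).symm :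
      GL (Fin 1) (PadicAlgCl p) →ₜ* (PadicAlgCl p)ˣ).comp rlam' * (((FramedRep.unitsContinuousMulEquivOfUnique (Fin 1) (PadicAlgCl p)).symm :
      GL (Fin 1) (PadicAlgCl p) →ₜ* (PadicAlgCl p)ˣ).comp rlam)⁻¹)) :=
    isPAdicAvatarOf_mul ι h12e' (isPAdicAvatarOf_inv ι h12e)
      (hram_of_forall h11' fun v hv => (h11 v hv).inv')
  have hfac : FactorsThroughZp κ ((FramedRep.unitsContinuousMulEquivOfUnique (Fin 1) (PadicAlgCl p) :
      (PadicAlgCl p)ˣ →ₜ* GL (Fin 1) (PadicAlgCl p)).comp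
      (((FramedRep.unitsContinuousMulEquivOfUnique (Fin 1) (PadicAlgCl p)).symm :
      GL (Fin 1) (PadicAlgCl p) →ₜ* (PadicAlgCl p)ˣ).comp rlam' * (((FramedRep.unitsContinuousMulEquivOfUnique (Fin 1) (PadicAlgCl p)).symm :
      GL (Fin 1) (PadicAlgCl p) →ₜ* (PadicAlgCl p)ˣ).comp rlam)⁻¹)) := by
    refine (factorsThroughZp_unitsChar_iff κ _).2 fun σ hσ => ?_
    rw [ContinuousMonoidHom.mul_apply, unitsChar_inv_apply, ContinuousMonoidHom.coe_comp,
      ContinuousMonoidHom.coe_comp, Function.comp_apply, Function.comp_apply, h13 σ hσ, h13' σ hσ,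
      map_one, inv_one, mul_one]
  have hfin : (lam' * lam⁻¹).IsFiniteOrder :=
    Summit.Langlands.Langlands.Theorems.ReciprocityUpToIrreducibility.stub_isFiniteOrder_of_hasInfinityType_zero
      K _ htype
  refine ⟨h8'.mul h8.inv, htype, fun x => ?_, hunr, havatar, hfac, hfin,
    exists_pow_prime_pow_eq_one ι hfin hunr havatar hfac⟩
  rw [HeckeCharacter.mul_apply, HeckeCharacter.inv_apply, h10 x, h10' x, inv_one, mul_one]

/-! ### §8. (K2-e): every `p^b`-th root of unity is the value at `γ` of an admissible twist -/

omit [NumberField K] in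
/-- `x ^ (m % n) = x ^ m` when `x ^ n = 1`. [folklore] -/
theorem pow_mod_eq_pow_of_pow_eq_one {M : Type*} [Monoid M] {x : M} {n : ℕ} (h : x ^ n = 1) (m : ℕ) :
    x ^ (m % n) = x ^ m := by
  conv_rhs => rw [← Nat.mod_add_div m n, pow_add, pow_mul, h, one_pow, mul_one]

/-- **(K2-e) TWIST-SUPPLY, existence / surjectivity.** Let `κ : Γ_K ↠ ℤ_p` with topological
generator `γ` (`κ γ = 1 ∈ ℤ_p`) and let `η ∈ ℚ̄_p` with `η^{p^b} = 1`. Then there is a pair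
`ε = (μ, r_μ)` — a Hecke character with `μ^{p^b} = 1`, unramified outside `p`, and its avatar `r_μ`,
which factors through `κ` — with `r_μ(γ) = η`. Construction: the character
`θ_η(σ) := η^{κ(σ) mod p^b}` of `Γ_K` has open kernel (`⊇ κ⁻¹(p^b ℤ_p)`), kills `ker κ` and the inertia
at every `v ∤ p` (`ZpExtension.inertia_le_kerSubgroup`); class field theory in the tree's
finite-order dictionary (`LambdaSupply.exists_hecke_of_isOpen_ker`, p7's (B)) provides `μ`, and
`μ^{p^b} = 1` by rigidity (the avatar of `μ^{p^b}` is `θ_η^{p^b} = 1`). Together with (K2-a)/(K2-b):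
the admissible pairs are `(λ₀, r₀) · {ε}` with `{ε̂} = Hom_cont(Γ⁻, μ_{p^∞})` EXACTLY. [folklore] -/
theorem exists_admissible_twist_of_pow_eq_one (ι : PadicAlgCl p ≃+* ℂ) {κ : ZpExtension K p}
    {γ : absoluteGaloisGroup K} (hγ : κ.IsTopGenerator γ) {b : ℕ} {η : PadicAlgCl p}
    (hη : η ^ (p ^ b) = 1) :
    ∃ (μ : HeckeCharacter K) (rμ : FramedGaloisRep K (PadicAlgCl p) 1), μ ^ (p ^ b) = 1 ∧
      (∀ v : HeightOneSpectrum (𝓞 K), ((p : ℕ) : 𝓞 K) ∉ v.asIdeal → μ.IsUnramifiedAt v) ∧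
      IsPAdicAvatarOf ι μ rμ ∧ FactorsThroughZp κ rμ ∧ avatarValueAt rμ γ = (η : ℂ_[p]) := by
  have hpp : p.Prime := Fact.out
  set n : ℕ := p ^ b with hn
  have hn0 : 0 < n := pow_pos hpp.pos b
  haveI : NeZero n := ⟨hn0.ne'⟩
  -- `η` as a unit of `p^b`-torsion
  have hη0 : η ≠ 0 := by
    rintro rfl
    rw [zero_pow hn0.ne'] at hη
    exact zero_ne_one hη
  set ηu : (PadicAlgCl p)ˣ := Units.mk0 η hη0 with hηu
  have hηun : ηu ^ n = 1 := Units.ext (by rw [Units.val_pow_eq_pow_val, Units.val_mk0, hη, Units.val_one])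
  -- the character `θ_η(σ) = η^{κ(σ) mod p^b}`
  let e : absoluteGaloisGroup K → ℕ := fun σ => (PadicInt.toZModPow b ((κ σ).toAdd)).val
  have he_one : e 1 = 0 := by simp only [e, map_one, toAdd_one, map_zero, ZMod.val_zero]
  have he_mul : ∀ σ τ, ηu ^ e (σ * τ) = ηu ^ e σ * ηu ^ e τ := by
    intro σ τ
    simp only [e, map_mul, toAdd_mul, map_add, ZMod.val_add, ← pow_add]
    exact pow_mod_eq_pow_of_pow_eq_one hηun _
  let θ : absoluteGaloisGroup K →* (PadicAlgCl p)ˣ :=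
    { toFun := fun σ => ηu ^ e σ
      map_one' := by simp only [he_one, pow_zero]
      map_mul' := he_mul }
  have hθ_apply : ∀ σ, θ σ = ηu ^ e σ := fun σ => rfl
  -- `θ` kills `ker κ`
  have hθfac : ∀ σ, κ σ = 1 → θ σ = 1 := by
    intro σ hσ
    rw [hθ_apply]
    simp only [e, hσ, toAdd_one, map_zero, ZMod.val_zero, pow_zero]
  -- `ker θ ⊇ κ⁻¹(p^b ℤ_p)` is open
  have hκc : Continuous fun σ : absoluteGaloisGroup K => (κ σ).toAdd :=
    continuous_toAdd.comp κ.toContinuousMonoidHom.continuous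
  have hUopen : IsOpen ((fun σ : absoluteGaloisGroup K => (κ σ).toAdd) ⁻¹'
      Metric.closedBall (0 : ℤ_[p]) ((p : ℝ) ^ (-(b : ℤ)))) :=
    (IsUltrametricDist.isOpen_closedBall (0 : ℤ_[p])
      (zpow_pos (by exact_mod_cast hpp.pos) _).ne').preimage hκc
  have hUsub : (fun σ : absoluteGaloisGroup K => (κ σ).toAdd) ⁻¹'
      Metric.closedBall (0 : ℤ_[p]) ((p : ℝ) ^ (-(b : ℤ))) ⊆ (θ.ker : Set (absoluteGaloisGroup K)) := by
    intro σ hσ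
    rw [Set.mem_preimage, Metric.mem_closedBall, dist_zero_right,
      PadicInt.norm_le_pow_iff_mem_span_pow, ← PadicInt.ker_toZModPow, RingHom.mem_ker] at hσ
    rw [SetLike.mem_coe, MonoidHom.mem_ker, hθ_apply]
    simp only [e, hσ, ZMod.val_zero, pow_zero]
  have hker : IsOpen (θ.ker : Set (absoluteGaloisGroup K)) :=
    θ.ker.isOpen_of_mem_nhds (g := 1)
      (Filter.mem_of_superset (hUopen.mem_nhds (by
        rw [Set.mem_preimage, map_one, toAdd_one, Metric.mem_closedBall, dist_self]
        positivity)) hUsub)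
  -- so `θ` is continuous
  have hθc : Continuous θ := by
    refine continuous_of_continuousAt_one θ ?_
    have hev : (fun σ => θ σ) =ᶠ[nhds 1] fun _ => 1 := by
      filter_upwards [hker.mem_nhds (θ.ker.one_mem)] with σ hσ
      exact hσ
    rw [ContinuousAt, map_one]
    exact (tendsto_const_nhds.congr' hev.symm)
  set θc : absoluteGaloisGroup K →ₜ* (PadicAlgCl p)ˣ := ⟨θ, hθc⟩ with hθc_def
  have hθc_apply : ∀ σ, θc σ = θ σ := fun σ => rfl
  -- class field theory: the finite-order Hecke character with avatar `θ`
  obtain ⟨μ, -, hdict, hunr⟩ := exists_hecke_of_isOpen_ker (K := K) ι θ hker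
  have hμ11 : ∀ v : HeightOneSpectrum (𝓞 K), ((p : ℕ) : 𝓞 K) ∉ v.asIdeal → μ.IsUnramifiedAt v :=
    fun v hv => hunr v fun 𝔓 h𝔓 σ hσ =>
      hθfac σ (ZpExtension.mem_kerSubgroup.mp
        (ZpExtension.inertia_le_kerSubgroup_holds (K := K) (p := p) κ hv h𝔓 hσ))
  have hμ12 : IsPAdicAvatarOf ι μ ((FramedRep.unitsContinuousMulEquivOfUnique (Fin 1) (PadicAlgCl p) :
      (PadicAlgCl p)ˣ →ₜ* GL (Fin 1) (PadicAlgCl p)).comp θc) :=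
    (isPAdicAvatarOf_unitsChar_iff ι μ θc).2 fun v hv hu => hdict v hv hu
  have hμ13 : FactorsThroughZp κ ((FramedRep.unitsContinuousMulEquivOfUnique (Fin 1) (PadicAlgCl p) :
      (PadicAlgCl p)ˣ →ₜ* GL (Fin 1) (PadicAlgCl p)).comp θc) :=
    (factorsThroughZp_unitsChar_iff κ θc).2 hθfac
  refine ⟨μ, (FramedRep.unitsContinuousMulEquivOfUnique (Fin 1) (PadicAlgCl p) :
      (PadicAlgCl p)ˣ →ₜ* GL (Fin 1) (PadicAlgCl p)).comp θc, ?_, hμ11, hμ12, hμ13, ?_⟩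
  · -- `μ^{p^b} = 1`: its avatar `θ^{p^b}` is trivial
    have hθn : θc ^ n = 1 := ContinuousMonoidHom.ext fun σ => by
      rw [ContinuousMonoidHom.pow_apply, hθc_apply, hθ_apply, ← pow_mul, mul_comm, pow_mul, hηun,
        one_pow]
      rfl
    have hpow := isPAdicAvatarOf_pow ι hμ12 hμ11 n
    rw [hθn] at hpow
    exact eq_of_isPAdicAvatarOf_of_isPAdicAvatarOf ι hpow (isPAdicAvatarOf_one ι)
      (fun v hv => isUnramifiedAt_pow' (hμ11 v hv) _) (fun v _ => isUnramifiedAt_one' v)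
  · -- the value at `γ`: `κ γ = 1 ∈ ℤ_p`, `1 mod p^b`, `η¹`
    rw [avatarValueAt, Matrix.GeneralLinearGroup.val_det_apply, Matrix.det_fin_one, unitsChar_apply_coe,
      hθc_apply, hθ_apply]
    have hκγ : (κ γ).toAdd = 1 := by
      rw [show κ γ = Multiplicative.ofAdd 1 from hγ, toAdd_ofAdd]
    rcases Nat.eq_zero_or_pos b with hb | hb
    · -- `b = 0`: `n = 1`, `η = 1`, and every `val` in `ZMod 1` is `0`
      have hn1 : n = 1 := by rw [hn, hb, pow_zero]
      have hη1 : η = 1 := by rw [← pow_one η, ← hn1]; exact hη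
      have he0 : e γ = 0 := by
        have hlt : e γ < n := ZMod.val_lt _
        rw [hn1] at hlt
        exact Nat.lt_one_iff.mp hlt
      rw [he0, pow_zero, Units.val_one, hη1]
    · haveI : Fact (1 < n) := ⟨Nat.one_lt_pow hb.ne' hpp.one_lt⟩
      have : e γ = 1 := by simp only [e, hκγ, map_one, ZMod.val_one]
      rw [this, pow_one, hηu, Units.val_mk0]

end Summit.BirchSwinnertonDyer.Rank1Residual.X11b.Three.LambdaSupply

end
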